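import Mathlib
import Summits.Ventures.HodgeRepro.Tier4.Line4.CompactCutFold
import Summits.Ventures.HodgeRepro.Tier4.Line4.LevelIndexCount

/-!
# Tier4/Line4/RatioGlue — THE (F) GLUE: the display (S-RATIO) from its NAMED pieces, the unfinished pieces as DISPLAYED
hypotheses in one abstract currency

Blind re-derivation cell `pub-hodge-repro`, Tier 4 «prove the step» (README §9–§10), seat t4-L1-p4 (gen 5; LINE L4; the
glue statement on plan-4 g6's word S15711 / S15739, taken S15744).  Tree path
`lean/Summits/Ventures/HodgeRepro/Tier4/Line4/RatioGlue.lean`.  Imports `Line4/CompactCutFold` (this seat, p710409: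
(F-a)+(F-b) `suppMeasureFolded_le_card_mul_projSet`), `Line4/LevelIndexCount` (t4-L4-p2, p708124: (S-IDX)
`exists_finset_cover_levelDoubleCoset`, the cover of the double coset by `≤ M₁` cosets, `M₁` free of `n`).  Mathlib-level;
no literature; no `def`.

THE SHAPE.  The display of record (S15514; TailGlue's `hratio` binder, p707793 L98–L102):
`∀ N (γ : rationalPoints W), ¬ transporter γ → (suppMeasureFolded W R γ₀ (p^(N+n₁)) γ).toReal ≤
 C′ · (suppMeasure W νf νf′ γ₀ DZf (p^(N+n₁)) γ₀).toReal`, `C′` free of `N` and `γ` — here proved for EVERY `γ` (the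
transporter clause is idle) from the chain
  `suppMeasureFolded N γ ≤ K_∞ · reps.card · νf′(L′_N) · νf(C ∩ projSet γ)`           (F-a)+(F-b), BY NAME, `C = π_f(closure D_T)`
  `reps.card ≤ M₁`                                                                       (S-IDX), BY NAME (LevelIndexCount)
  `νf(C ∩ projSet γ) ≤ κ · u N`                                                          (F-c), DISPLAYED — `u N` the CURRENCY
  `u N · νf′(L′_N) ≤ M₂ · suppMeasure N γ₀`                                              the UNIT in that currency, DISPLAYED
with `K_∞ = c ν_∞(T_∞) c′ ν′_∞(T′_∞)` (the chain's Haar normalisations) and `C′ := K_∞.toReal · M₁ · κ.toReal · M₂.toReal`.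
THE CURRENCY `u N` is a free function `ℕ → ℝ≥0∞`: the glue does not decide what it is.  The intended instance (S15641 (3),
S15737, S15738, S15739) is `u n := c_q · νS((Z_S ⊓ B(1)) · B(q^{n−c₀})) · νA(π^{(q)} C)` (L1-p1's (F-c)
`exists_measure_inter_projSet_le_of_isCompact`, whose right side IS `κ · u n` up to associativity), and the unit hypothesis
decomposes as `unit_of_currency_of_beta` below: a CURRENCY MATCH `u n ≤ M₃ · v n` with `v n := νf(Z⁰_f · L_N)` (PSPLIT's
split of `νf` + P3's index `[B(q^{n−c₀}) : B(qⁿ)] ≤ M(q^{c₀})` through IndexMeasure + the covering of the compact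
`π^{(q)} C` by level-one cosets away from `q`) and the (β) unit of record `v n · νf′(L′_N) ≤ #Γ₀ · suppMeasure N γ₀`
(typer-1's SaturationMeasure (β1) + ProdSliceBound (β2), L2-p2's UnitInstance).  Every displayed hypothesis is stated so
that the module proving it binds by name without re-shaping; nothing here assumes `hDZ`, a product domain, or the
transporter clause.

* `suppMeasureFolded_le_mul_of_pieces` — the `ℝ≥0∞` chain at ONE level, ONE `γ`, ONE cover `reps`.
* `unit_of_currency_of_beta` — the unit hypothesis from the currency match and the (β) unit.
* **`ratio_display_of_pieces`** — the display over ALL `γ` along any level sequence `lev` (`lev n ≠ 0`), `C′` free of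
  `n` and `γ`; `ratio_display_of_pieces_cover` — the same with (S-IDX) BY NAME (`exists_finset_cover_levelDoubleCoset` at
  `γ₀,f` with the integrality of `γ₀, γ₀⁻¹` above `p`, LevelPrime's clause).
* **`hratio_of_pieces`** — TailGlue's `hratio` binder VERBATIM (`p^(N+n₁)`, the transporter clause in front).

Nothing here says anything about the status of the Hodge conjecture for CM abelian varieties, which is NOT proved
(HC_CM is NOT proved by anyone in this repository).
-/

set_option autoImplicit false
noncomputable section
namespace Summit.Ventures.HodgeRepro.Tier4.Line4
open Summit.Ventures.HodgeRepro.Tier4 Summit.Ventures.HodgeRepro.Tier4.Common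
  Summit.Ventures.HodgeRepro.Tier4.Line1 MeasureTheory IsDedekindDomain NumberField
open scoped ENNReal NNReal Pointwise

section Chain
variable {k : Type} [Field k] [NumberField k] (W : PlaneData k) [MeasurableSpace (GA W)] [BorelSpace (GA W)]
  (R : RTFData W)

/-- **The `ℝ≥0∞` chain at one level and one `γ`**: (F-a)+(F-b) by name, then the displayed (F-c) bound
`νf(C ∩ projSet γ) ≤ κ · u` at the compact cut `C = π_f(closure D_T)` and the displayed unit bound
`u · νf′(L′_N) ≤ M₂ · suppMeasure N γ₀`:
`suppMeasureFolded N γ ≤ (K_∞ · reps.card · κ · M₂) · suppMeasure N γ₀`. -/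
theorem suppMeasureFolded_le_mul_of_pieces (hR : R.IsHaar)
    (compT : IsCompact (closure R.DT)) (compT' : IsCompact (closure R.DT'))
    (νinf : Measure (torusInf W)) [νinf.IsHaarMeasure] (νf : Measure (torusFin W)) [νf.IsHaarMeasure]
    (c : ℝ≥0) (hc : R.μT = c • Measure.map (torusSplit W).symm (νinf.prod νf))
    (νinf' : Measure (torusInf' W)) [νinf'.IsHaarMeasure] (νf' : Measure (torusFin' W)) [νf'.IsHaarMeasure]
    (c' : ℝ≥0) (hc' : R.μT' = c' • Measure.map (torusSplit' W).symm (νinf'.prod νf'))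
    (γ₀ : GA W) (DZf : Set (torusFin W)) {N : ℕ} (hN : N ≠ 0) (γ : GA W) (reps : Finset (GA W))
    (hcov : levelDoubleCoset W N (GA.ofFinPart W γ₀) ⊆ ⋃ g ∈ reps, g • (levelK W N : Set (GA W)))
    (u κ : ℝ≥0∞) (hproj : νf (finTf W '' closure R.DT ∩ projSet W γ₀ N γ) ≤ κ * u)
    (M₂ : ℝ≥0∞) (hunit : u * νf' (levelTf' W N) ≤ M₂ * suppMeasure W νf νf' γ₀ DZf N γ₀) :
    suppMeasureFolded W R γ₀ N γ ≤
      (((c : ℝ≥0∞) * νinf Set.univ * ((c' : ℝ≥0∞) * νinf' Set.univ)) * reps.card * κ * M₂) *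
        suppMeasure W νf νf' γ₀ DZf N γ₀ := by
  set K : ℝ≥0∞ := (c : ℝ≥0∞) * νinf Set.univ * ((c' : ℝ≥0∞) * νinf' Set.univ) with hK
  calc suppMeasureFolded W R γ₀ N γ
      ≤ K * (reps.card * νf' (levelTf' W N) * νf (finTf W '' closure R.DT ∩ projSet W γ₀ N γ)) :=
        suppMeasureFolded_le_card_mul_projSet W R hR compT compT' νinf νf c hc νinf' νf' c' hc' γ₀ hN γ reps hcov
    _ ≤ K * (reps.card * νf' (levelTf' W N) * (κ * u)) := by gcongr
    _ = K * reps.card * κ * (u * νf' (levelTf' W N)) := by ring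
    _ ≤ K * reps.card * κ * (M₂ * suppMeasure W νf νf' γ₀ DZf N γ₀) := by gcongr
    _ = _ := by ring

end Chain

section Unit
variable {k : Type} [Field k] [NumberField k] (W : PlaneData k) [MeasurableSpace (GA W)]
  (νf : Measure (torusFin W)) (νf' : Measure (torusFin' W)) (γ₀ : GA W) (DZf : Set (torusFin W))

/-- **The unit hypothesis from the currency match and the (β) unit**: if `u n ≤ M₃ · v n` (the currency match: PSPLIT +
P3 + IndexMeasure + the away-from-`q` covering) and `v n · νf′(L′_N) ≤ M₄ · suppMeasure N γ₀` ((β): SaturationMeasure +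
ProdSliceBound at `v n = νf(Z⁰_f · L_N)`), then `u n · νf′(L′_N) ≤ (M₃ · M₄) · suppMeasure N γ₀`. -/
theorem unit_of_currency_of_beta (lev : ℕ → ℕ) (u v : ℕ → ℝ≥0∞) (M₃ M₄ : ℝ≥0∞)
    (hcur : ∀ n, u n ≤ M₃ * v n)
    (hβ : ∀ n, v n * νf' (levelTf' W (lev n)) ≤ M₄ * suppMeasure W νf νf' γ₀ DZf (lev n) γ₀) (n : ℕ) :
    u n * νf' (levelTf' W (lev n)) ≤ (M₃ * M₄) * suppMeasure W νf νf' γ₀ DZf (lev n) γ₀ := by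
  calc u n * νf' (levelTf' W (lev n)) ≤ M₃ * v n * νf' (levelTf' W (lev n)) := mul_le_mul_left (hcur n) _
    _ = M₃ * (v n * νf' (levelTf' W (lev n))) := by ring
    _ ≤ M₃ * (M₄ * suppMeasure W νf νf' γ₀ DZf (lev n) γ₀) := mul_le_mul_right (hβ n) _
    _ = _ := by ring

end Unit

section Display
variable {k : Type} [Field k] [NumberField k] (W : PlaneData k) [MeasurableSpace (GA W)] [BorelSpace (GA W)]
  (R : RTFData W)

/-- **THE (F) DISPLAY FROM THE PIECES, over ALL `γ`, along any level sequence `lev` with `lev n ≠ 0`**: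
`∃ C′, ∀ n (γ : rationalPoints W), (suppMeasureFolded (lev n) γ).toReal ≤ C′ · (suppMeasure (lev n) γ₀).toReal`, with
`C′ = K_∞.toReal · M₁ · κ.toReal · M₂.toReal` free of `n` and `γ`.  Displayed pieces: (S-IDX) `hreps` (a cover of the
double coset at every level by `≤ M₁` cosets of `K(lev n)`), (F-c) `hproj` (the projection cut by `π_f(closure D_T)` is
`≤ κ · u n`), the unit `hunit` (`u n · νf′(L′_{lev n}) ≤ M₂ · suppMeasure (lev n) γ₀`), the finiteness `hfin` of the unit
(`suppMeasure_ne_top`: PROPER + ZDOMAIN-EX (iv)); `κ`, `M₂` finite; `ν_∞`, `ν′_∞` finite (compact archimedean tori). -/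
theorem ratio_display_of_pieces (hR : R.IsHaar)
    (compT : IsCompact (closure R.DT)) (compT' : IsCompact (closure R.DT'))
    (νinf : Measure (torusInf W)) [νinf.IsHaarMeasure] [IsFiniteMeasure νinf]
    (νf : Measure (torusFin W)) [νf.IsHaarMeasure]
    (c : ℝ≥0) (hc : R.μT = c • Measure.map (torusSplit W).symm (νinf.prod νf))
    (νinf' : Measure (torusInf' W)) [νinf'.IsHaarMeasure] [IsFiniteMeasure νinf']
    (νf' : Measure (torusFin' W)) [νf'.IsHaarMeasure]
    (c' : ℝ≥0) (hc' : R.μT' = c' • Measure.map (torusSplit' W).symm (νinf'.prod νf'))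
    (γ₀ : GA W) (DZf : Set (torusFin W)) (lev : ℕ → ℕ) (hlev : ∀ n, lev n ≠ 0)
    (M₁ : ℕ) (hreps : ∀ n, ∃ reps : Finset (GA W), reps.card ≤ M₁ ∧
      levelDoubleCoset W (lev n) (GA.ofFinPart W γ₀) ⊆ ⋃ g ∈ reps, g • (levelK W (lev n) : Set (GA W)))
    (u : ℕ → ℝ≥0∞) (κ : ℝ≥0∞) (hκ : κ ≠ ⊤)
    (hproj : ∀ (n : ℕ) (γ : GA W), νf (finTf W '' closure R.DT ∩ projSet W γ₀ (lev n) γ) ≤ κ * u n)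
    (M₂ : ℝ≥0∞) (hM₂ : M₂ ≠ ⊤)
    (hunit : ∀ n, u n * νf' (levelTf' W (lev n)) ≤ M₂ * suppMeasure W νf νf' γ₀ DZf (lev n) γ₀)
    (hfin : ∀ n, suppMeasure W νf νf' γ₀ DZf (lev n) γ₀ ≠ ⊤) :
    ∃ C' : ℝ, ∀ (n : ℕ) (γ : rationalPoints W),
      (suppMeasureFolded W R γ₀ (lev n) (γ : GA W)).toReal ≤
        C' * (suppMeasure W νf νf' γ₀ DZf (lev n) γ₀).toReal := by
  set K : ℝ≥0∞ := (c : ℝ≥0∞) * νinf Set.univ * ((c' : ℝ≥0∞) * νinf' Set.univ) with hK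
  have hKtop : K ≠ ⊤ := by
    rw [hK]
    exact ENNReal.mul_ne_top (ENNReal.mul_ne_top ENNReal.coe_ne_top (measure_ne_top _ _))
      (ENNReal.mul_ne_top ENNReal.coe_ne_top (measure_ne_top _ _))
  refine ⟨K.toReal * M₁ * κ.toReal * M₂.toReal, fun n γ => ?_⟩
  obtain ⟨reps, hcard, hcov⟩ := hreps n
  have h := suppMeasureFolded_le_mul_of_pieces W R hR compT compT' νinf νf c hc νinf' νf' c' hc' γ₀ DZf (hlev n)
    (γ : GA W) reps hcov (u n) κ (hproj n (γ : GA W)) M₂ (hunit n)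
  -- bound `reps.card` by `M₁`
  have h' : suppMeasureFolded W R γ₀ (lev n) (γ : GA W) ≤
      (K * M₁ * κ * M₂) * suppMeasure W νf νf' γ₀ DZf (lev n) γ₀ := by
    have hcard' : (reps.card : ℝ≥0∞) ≤ M₁ := by exact_mod_cast hcard
    refine h.trans ?_
    gcongr
  have hne : K * M₁ * κ * M₂ * suppMeasure W νf νf' γ₀ DZf (lev n) γ₀ ≠ ⊤ :=
    ENNReal.mul_ne_top (ENNReal.mul_ne_top (ENNReal.mul_ne_top (ENNReal.mul_ne_top hKtop
      (ENNReal.natCast_ne_top M₁)) hκ) hM₂) (hfin n)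
  have h'' := ENNReal.toReal_mono hne h'
  rw [ENNReal.toReal_mul, ENNReal.toReal_mul, ENNReal.toReal_mul, ENNReal.toReal_mul, ENNReal.toReal_natCast] at h''
  exact h''

/-- **The display with (S-IDX) BY NAME**: the cover `hreps` from LevelIndexCount's `exists_finset_cover_levelDoubleCoset`
at `γ₀,f` along `lev n = p ^ (n + n₁)`, under the integrality of `γ₀, γ₀⁻¹` at the places above `p` (LevelPrime's clause). -/
theorem ratio_display_of_pieces_cover (hR : R.IsHaar)
    (compT : IsCompact (closure R.DT)) (compT' : IsCompact (closure R.DT'))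
    (νinf : Measure (torusInf W)) [νinf.IsHaarMeasure] [IsFiniteMeasure νinf]
    (νf : Measure (torusFin W)) [νf.IsHaarMeasure]
    (c : ℝ≥0) (hc : R.μT = c • Measure.map (torusSplit W).symm (νinf.prod νf))
    (νinf' : Measure (torusInf' W)) [νinf'.IsHaarMeasure] [IsFiniteMeasure νinf']
    (νf' : Measure (torusFin' W)) [νf'.IsHaarMeasure]
    (c' : ℝ≥0) (hc' : R.μT' = c' • Measure.map (torusSplit' W).symm (νinf'.prod νf'))
    (γ₀ : GA W) (DZf : Set (torusFin W)) (p n₁ : ℕ) (hp : p ≠ 0)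
    (hγ₀ : ∀ v : HeightOneSpectrum (𝓞 k), (p : 𝓞 k) ∈ v.asIdeal → ∀ i j,
      Valued.v (finPart k (GA.mat W (GA.ofFinPart W γ₀) i j) v) ≤ 1)
    (hγ₀' : ∀ v : HeightOneSpectrum (𝓞 k), (p : 𝓞 k) ∈ v.asIdeal → ∀ i j,
      Valued.v (finPart k (GA.mat W (GA.ofFinPart W γ₀)⁻¹ i j) v) ≤ 1)
    (u : ℕ → ℝ≥0∞) (κ : ℝ≥0∞) (hκ : κ ≠ ⊤)
    (hproj : ∀ (n : ℕ) (γ : GA W), νf (finTf W '' closure R.DT ∩ projSet W γ₀ (p ^ (n + n₁)) γ) ≤ κ * u n)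
    (M₂ : ℝ≥0∞) (hM₂ : M₂ ≠ ⊤)
    (hunit : ∀ n, u n * νf' (levelTf' W (p ^ (n + n₁))) ≤ M₂ * suppMeasure W νf νf' γ₀ DZf (p ^ (n + n₁)) γ₀)
    (hfin : ∀ n, suppMeasure W νf νf' γ₀ DZf (p ^ (n + n₁)) γ₀ ≠ ⊤) :
    ∃ C' : ℝ, ∀ (n : ℕ) (γ : rationalPoints W),
      (suppMeasureFolded W R γ₀ (p ^ (n + n₁)) (γ : GA W)).toReal ≤
        C' * (suppMeasure W νf νf' γ₀ DZf (p ^ (n + n₁)) γ₀).toReal := by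
  obtain ⟨M₁, hM₁⟩ := exists_finset_cover_levelDoubleCoset W (ofFinPart_mem_finitePart W γ₀) p hγ₀ hγ₀'
  exact ratio_display_of_pieces W R hR compT compT' νinf νf c hc νinf' νf' c' hc' γ₀ DZf (fun n => p ^ (n + n₁))
    (fun n => pow_ne_zero _ hp) M₁ (fun n => hM₁ (n + n₁)) u κ hκ hproj M₂ hM₂ hunit hfin

/-- **TailGlue's `hratio` binder VERBATIM** (p707793 L98–L102: the transporter clause in front, idle here), from the
display over all `γ`. -/
theorem hratio_of_pieces (hR : R.IsHaar)
    (compT : IsCompact (closure R.DT)) (compT' : IsCompact (closure R.DT'))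
    (νinf : Measure (torusInf W)) [νinf.IsHaarMeasure] [IsFiniteMeasure νinf]
    (νf : Measure (torusFin W)) [νf.IsHaarMeasure]
    (c : ℝ≥0) (hc : R.μT = c • Measure.map (torusSplit W).symm (νinf.prod νf))
    (νinf' : Measure (torusInf' W)) [νinf'.IsHaarMeasure] [IsFiniteMeasure νinf']
    (νf' : Measure (torusFin' W)) [νf'.IsHaarMeasure]
    (c' : ℝ≥0) (hc' : R.μT' = c' • Measure.map (torusSplit' W).symm (νinf'.prod νf'))
    (γ₀ : GA W) (DZf : Set (torusFin W)) (p n₁ : ℕ) (hp : p ≠ 0)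
    (M₁ : ℕ) (hreps : ∀ n, ∃ reps : Finset (GA W), reps.card ≤ M₁ ∧
      levelDoubleCoset W (p ^ (n + n₁)) (GA.ofFinPart W γ₀) ⊆ ⋃ g ∈ reps, g • (levelK W (p ^ (n + n₁)) : Set (GA W)))
    (u : ℕ → ℝ≥0∞) (κ : ℝ≥0∞) (hκ : κ ≠ ⊤)
    (hproj : ∀ (n : ℕ) (γ : GA W), νf (finTf W '' closure R.DT ∩ projSet W γ₀ (p ^ (n + n₁)) γ) ≤ κ * u n)
    (M₂ : ℝ≥0∞) (hM₂ : M₂ ≠ ⊤)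
    (hunit : ∀ n, u n * νf' (levelTf' W (p ^ (n + n₁))) ≤ M₂ * suppMeasure W νf νf' γ₀ DZf (p ^ (n + n₁)) γ₀)
    (hfin : ∀ n, suppMeasure W νf νf' γ₀ DZf (p ^ (n + n₁)) γ₀ ≠ ⊤) :
    ∃ C' : ℝ, ∀ (N : ℕ) (γ : rationalPoints W),
      ¬ ((torusT W).map (MulAut.conj ((γ : GA W))⁻¹).toMonoidHom = torusT' W) →
      (suppMeasureFolded W R γ₀ (p ^ (N + n₁)) (γ : GA W)).toReal ≤
        C' * (suppMeasure W νf νf' γ₀ DZf (p ^ (N + n₁)) γ₀).toReal := by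
  obtain ⟨C', hC'⟩ := ratio_display_of_pieces W R hR compT compT' νinf νf c hc νinf' νf' c' hc' γ₀ DZf
    (fun n => p ^ (n + n₁)) (fun n => pow_ne_zero _ hp) M₁ hreps u κ hκ hproj M₂ hM₂ hunit hfin
  exact ⟨C', fun N γ _ => hC' N γ⟩

end Display

end Summit.Ventures.HodgeRepro.Tier4.Line4

end
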